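import Literature.Topology.FourManifolds.BoundaryFlowout
import Literature.Topology.FourManifolds.RegularSlabField
import Literature.Topology.FourManifolds.MorseTurnAbout
import HarnessLib

/-!
# The levels of a Morse function on a cobordism near its ends are homeomorphic to the ends
# (Milnor 1965, Thm. 3.4 near `V₀` and `V₁`: the collar levels)

Topic `Literature/Topology/FourManifolds` (fact seat
`provefact-Literature.Topology.FourManifolds.Cobord-79c3e8bec0`, proof of the named fact
`Literature.Topology.FourManifolds.Cobordism.Milnor1965_simplyConnected_levels` of
`HCobordismMiddleStep.lean`: the simple connectivity of the ends `M`, `N` of the cobordism is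
transported to the nearby levels `f⁻¹(ε)`, `f⁻¹(1 - ε)`).  Milnor, *Lectures on the h-cobordism
theorem* (1965), Thm. 3.4 and its proof (PDF pp. 12–13 of the held copy): a triad without
critical points is a product, the diffeomorphism `h : V₀ × [0, 1] → W` being
`h(y₀, s) = ψ_{y₀}(s)` — follow the integral curves of the normalised gradient-like field from
the boundary; Cor. 3.5 (collar neighbourhood).  Applied to the collars `f⁻¹[0, ε]`,
`f⁻¹[1 - ε, 1]` of a Morse function `f` on a cobordism `(W; M, N)` (Def. 3.1: `f = 0` exactly
on `M`, `f = 1` exactly on `N`, no critical point near `∂W`), the slices of `h` identify `M`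
with the levels `f⁻¹(ε)` for all small `ε > 0`.

Lean route (everything **proved**): the boundary flow-out of `BoundaryFlowout.lean`
(`Literature.Topology.FourManifolds.FlowoutInput`, its finite `Cover` by chart boxes, the flow-out
`Fl z t` with `g (Fl z t) = g z + t`, the retraction `ret` to `∂W` and the two inversion
identities) for the boundary-defining function `g = f (1 - f)` — smooth, `≥ 0`, vanishing
exactly on `∂W = M ⊔ N` and regular there — and a vector field `ξ` with `ξ(g) = 1` near `∂W`
(`RegularSlabField.lean`); along a flow-out curve `f` cannot cross `1/2` while `g < 1/4`, so
the curves from `M` stay near `M`, and `x ↦ Fl (inl x) (ε(1 - ε))`, `w ↦ inl⁻¹ (ret w)` are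
inverse homeomorphisms `M ≃ₜ f⁻¹(ε)` (`Cobordism.IsMorseFunction.exists_homeomorph_level`);
turning the cobordism about gives `N ≃ₜ f⁻¹(1 - ε)` (`…exists_homeomorph_level'`).

## References

* J. Milnor, *Lectures on the h-cobordism theorem*, notes by L. Siebenmann and J. Sondow,
  Princeton Mathematical Notes (1965), Def. 2.3/3.1 (PDF p. 11), Thm. 3.4 and its proof, Cor. 3.5
  (PDF pp. 12–13).  Held: `lit read book:milnornd-lectures-h-cobordism-theorem`.
  [MilnorHCobordism1965]
* J. M. Lee, *Introduction to Smooth Manifolds*, 2nd ed., GTM 218 (2013), Thm. 9.24–9.25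
  (boundary flowout, collars). [LeeSmoothManifolds2013]
-/

open scoped Manifold ContDiff Topology
open Set Function Filter

noncomputable section

namespace Literature.Topology.FourManifolds

universe u

variable {n : ℕ} {M N : Type u} [TopologicalSpace M] [ChartedSpace (EuclideanSpace ℝ (Fin n)) M]
  [TopologicalSpace N] [ChartedSpace (EuclideanSpace ℝ (Fin n)) N]

namespace Cobordism.IsMorseFunction

/-- An elementary root computation: if `t (1 - t) = ε (1 - ε)` with `t, ε < 1/2` then
`t = ε`. [folklore] -/
theorem eq_of_mul_one_sub_eq {t ε : ℝ} (h : t * (1 - t) = ε * (1 - ε)) (ht : t < 1 / 2)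
    (hε : ε < 1 / 2) : t = ε := by
  have h1 : (t - ε) * (1 - t - ε) = 0 := by linear_combination h
  rcases mul_eq_zero.1 h1 with h2 | h2
  · linarith
  · linarith

/-- **A flow-out input from a Morse function on a cobordism**: `g = f (1 - f)` is smooth, `≥ 0`,
vanishes exactly on `∂W` and is regular there (no critical point of `f` lies on `∂W`,
Def. 3.1), so for some `δ > 0` there is a smooth field `ξ` with `ξ(g) = 1` on `{g ≤ δ}`
(`RegularSlabField.lean`, Milnor's normalised gradient-like field of the proof of Thm. 3.4).
[cite: MilnorHCobordism1965, Def. 3.1 (PDF p. 11), proof of Thm. 3.4 (PDF p. 13)] -/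
theorem exists_flowoutInput {c : Cobordism n M N} {f : c.W → ℝ} (hf : c.IsMorseFunction f) :
    ∃ D : FlowoutInput n c.W, ∀ z, D.f z = f z * (1 - f z) := by
  classical
  set g : c.W → ℝ := fun z => f z * (1 - f z) with hg
  have hfs : ContMDiff (𝓡∂ (n + 1)) 𝓘(ℝ, ℝ) ∞ f := hf.isMorse.contMDiff
  have hgs : ContMDiff (𝓡∂ (n + 1)) 𝓘(ℝ, ℝ) ∞ g := hfs.mul (contMDiff_const.sub hfs)
  have hg0 : ∀ z, 0 ≤ g z := fun z => by
    have := hf.mem_Icc z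
    exact mul_nonneg this.1 (by linarith [this.2])
  have hgb : ∀ z, g z = 0 ↔ z ∈ (𝓡∂ (n + 1)).boundary c.W := by
    intro z
    constructor
    · intro hz
      by_contra hzb
      have hzi : (𝓡∂ (n + 1)).IsInteriorPoint z :=
        ((𝓡∂ (n + 1)).isInteriorPoint_or_isBoundaryPoint z).resolve_right hzb
      have h01 := hf.2.2.2.2 z hzi
      rcases mul_eq_zero.1 hz with h | h
      · exact h01.1.ne' h
      · exact h01.2.ne (by linarith)
    · intro hz
      rw [← c.range_inl_union_range_inr] at hz
      rcases hz with ⟨x, rfl⟩ | ⟨y, rfl⟩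
      · simp only [hg, hf.2.1 x, zero_mul]
      · simp only [hg, hf.2.2.1 y, sub_self, mul_zero]
  have hreg : ∀ z, g z = 0 → mfderiv (𝓡∂ (n + 1)) 𝓘(ℝ, ℝ) g z ≠ 0 := by
    intro z hz
    have hzb := (hgb z).1 hz
    set Df : TangentSpace (𝓡∂ (n + 1)) z →L[ℝ] ℝ := mfderiv (𝓡∂ (n + 1)) 𝓘(ℝ, ℝ) f z with hDf
    have hcrit : Df ≠ 0 := hf.2.2.2.1 z hzb
    have hD : HasMFDerivAt (𝓡∂ (n + 1)) 𝓘(ℝ, ℝ) f z Df :=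
      (hfs.mdifferentiableAt (by simp)).hasMFDerivAt
    have hD' : HasMFDerivAt (𝓡∂ (n + 1)) 𝓘(ℝ, ℝ) (fun w => 1 - f w) z
        ((0 : TangentSpace (𝓡∂ (n + 1)) z →L[ℝ] ℝ) - Df) :=
      (hasMFDerivAt_const (I := 𝓡∂ (n + 1)) (I' := 𝓘(ℝ, ℝ)) (1 : ℝ) z).sub hD
    have hprod := hD.mul hD'
    have heq : g = f * fun w => 1 - f w := by funext w; rfl
    rw [heq, hprod.mfderiv]
    have h01 : f z = 0 ∨ f z = 1 := by
      rw [← c.range_inl_union_range_inr] at hzb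
      rcases hzb with ⟨x, rfl⟩ | ⟨y, rfl⟩
      · exact Or.inl (hf.2.1 x)
      · exact Or.inr (hf.2.2.1 y)
    rcases h01 with h0 | h1
    · simp only [h0, zero_smul, sub_zero, one_smul, zero_add]
      exact hcrit
    · simp only [h1, one_smul, sub_self, zero_smul, add_zero, zero_sub, ne_eq]
      exact neg_ne_zero.2 hcrit
  obtain ⟨δ', hδ', hδ'reg⟩ := exists_pos_forall_mfderiv_ne_zero hgs hg0 hreg
  set δ := δ' / 2 with hδ
  have hδpos : 0 < δ := by positivity
  have hreg2 : ∀ z ∈ {z : c.W | g z ≤ δ}, mfderiv (𝓡∂ (n + 1)) 𝓘(ℝ, ℝ) g z ≠ 0 := fun z hz =>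
    hδ'reg z (by simp only [mem_setOf_eq] at hz; linarith)
  obtain ⟨ξ, hξ⟩ := exists_contMDiffSection_mlineDeriv_eq_one_on hgs
    (isClosed_le hgs.continuous continuous_const) hreg2
  exact ⟨⟨g, ξ, δ, hδpos, hgs, hg0, hgb, ξ.contMDiff, fun z hz => hξ z hz⟩, fun z => rfl⟩

/-- **The levels near the incoming end are homeomorphic to it.**  For a Morse function `f` on a
cobordism `(W; M, N)` there is `ε₀ > 0` such that `M ≃ₜ f⁻¹(ε)` for every `0 < ε ≤ ε₀`: the
slices of Milnor's collar `h(y₀, s) = ψ_{y₀}(s)` (Thm. 3.4), here the flow-out `x ↦ Fl (inl x) (ε(1 - ε))`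
of the boundary-defining function `g = f (1 - f)` with inverse `w ↦ inl⁻¹ (ret w)`
(`BoundaryFlowout.lean`); along the flow-out curves `g < 1/4`, so `f` stays `< 1/2` and the
curves from `M` end on `f⁻¹(ε)` rather than on `f⁻¹(1 - ε)`. [cite: MilnorHCobordism1965, Thm. 3.4 and its proof, Cor. 3.5 (PDF pp. 12–13)] -/
theorem exists_homeomorph_level {c : Cobordism n M N} {f : c.W → ℝ} (hf : c.IsMorseFunction f) :
    ∃ ε₀ : ℝ, 0 < ε₀ ∧ ∀ ε, 0 < ε → ε ≤ ε₀ → Nonempty (M ≃ₜ ↥(f ⁻¹' {ε})) := by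
  classical
  obtain ⟨D, hD⟩ := hf.exists_flowoutInput
  set Γ : D.Cover := Classical.choice D.nonempty_cover with hΓ
  have ha := Γ.a_pos
  have hfs : Continuous f := hf.isMorse.contMDiff.continuous
  have hgc : Continuous D.f := D.f_smooth.continuous
  refine ⟨min (Γ.a / 2) (1 / 8), by positivity, fun ε hε hεε₀ => ?_⟩
  have hεa : ε ≤ Γ.a / 2 := hεε₀.trans (min_le_left _ _)
  have hε8 : ε ≤ 1 / 8 := hεε₀.trans (min_le_right _ _)
  set e : ℝ := ε * (1 - ε) with he_def
  have he0 : 0 < e := mul_pos hε (by linarith)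
  have heε : e ≤ ε := by rw [he_def]; nlinarith
  have hea : e < Γ.a := by linarith
  have he4 : e < 1 / 4 := by linarith
  -- along a flow-out curve `f` does not cross `1/2` while `g < 1/4`
  have stay : ∀ z, D.f z ≤ Γ.a → f z < 1 / 2 → D.f z < 1 / 4 → ∀ {T : ℝ}, T ∈ Icc (-D.f z) Γ.a →
      D.f z + T < 1 / 4 → f (Γ.Fl z T) < 1 / 2 := by
    intro z hz hfz hz4 T hT hT4
    by_contra hge
    push Not at hge
    have hsub : uIcc 0 T ⊆ Icc (-D.f z) Γ.a := by
      rcases le_total 0 T with h | h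
      · rw [uIcc_of_le h]; exact Icc_subset_Icc (by linarith [D.f_nonneg z]) hT.2
      · rw [uIcc_of_ge h]; exact Icc_subset_Icc hT.1 ha.le
    have hcont : ContinuousOn (fun s => f (Γ.Fl z s)) (uIcc 0 T) :=
      hfs.comp_continuousOn ((Γ.isMIntegralCurveOn_Fl hz).continuousOn.mono hsub)
    have h0 : f (Γ.Fl z 0) = f z := by rw [Γ.Fl_zero hz]
    have hmem : (1 / 2 : ℝ) ∈ uIcc (f (Γ.Fl z 0)) (f (Γ.Fl z T)) := by
      rw [h0, uIcc_of_le (hfz.le.trans hge)]; exact ⟨hfz.le, hge⟩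
    obtain ⟨s, hs, hfs'⟩ := intermediate_value_uIcc hcont hmem
    have hgs : D.f (Γ.Fl z s) = D.f z + s := Γ.f_Fl hz (hsub hs)
    have hfs'' : f (Γ.Fl z s) = 1 / 2 := hfs'
    have hval : D.f (Γ.Fl z s) = 1 / 4 := by rw [hD, hfs'']; norm_num
    have hlt : D.f z + s < 1 / 4 := by
      rcases le_total 0 T with h | h
      · rw [uIcc_of_le h] at hs; linarith [hs.2]
      · rw [uIcc_of_ge h] at hs; linarith [hs.2]
    linarith
  -- values of `f` and `g` on `inl M` and on the level
  have hg_inl : ∀ x, D.f (c.inl x) = 0 := fun x => by rw [hD, hf.2.1 x, zero_mul]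
  have hg_lev : ∀ w : c.W, f w = ε → D.f w = e := fun w hw => by rw [hD, hw]
  -- the flow-out of `inl x` at height `e` lies on the level `ε`
  have hFl_lev : ∀ x, f (Γ.Fl (c.inl x) e) = ε := by
    intro x
    have hz : D.f (c.inl x) ≤ Γ.a := by rw [hg_inl]; exact ha.le
    have heI : e ∈ Icc (-D.f (c.inl x)) Γ.a := by rw [hg_inl, neg_zero]; exact ⟨he0.le, hea.le⟩
    have hhalf : f (Γ.Fl (c.inl x) e) < 1 / 2 :=
      stay _ hz (by rw [hf.2.1 x]; norm_num) (by rw [hg_inl]; norm_num) heI (by rw [hg_inl]; linarith)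
    have hge : D.f (Γ.Fl (c.inl x) e) = e := by rw [Γ.f_Fl hz heI, hg_inl, zero_add]
    rw [hD] at hge
    exact eq_of_mul_one_sub_eq hge hhalf (by linarith)
  -- the retraction of a point of the level lies on `inl M`
  have hret_mem : ∀ w : c.W, f w = ε → Γ.ret w ∈ range c.inl := by
    intro w hw
    have hgw := hg_lev w hw
    have hwa : D.f w ≤ Γ.a := by rw [hgw]; exact hea.le
    have hb : Γ.ret w ∈ (𝓡∂ (n + 1)).boundary c.W := Γ.ret_mem_boundary hwa
    have hhalf : f (Γ.ret w) < 1 / 2 := by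
      change f (Γ.Fl w (-D.f w)) < 1 / 2
      refine stay w hwa (by rw [hw]; linarith) (by rw [hgw]; exact he4) ⟨le_rfl, ?_⟩ (by norm_num)
      linarith [D.f_nonneg w]
    rw [← c.range_inl_union_range_inr] at hb
    rcases hb with h | ⟨y, hy⟩
    · exact h
    · exfalso
      rw [← hy, hf.2.2.1 y] at hhalf
      norm_num at hhalf
  -- continuity of the flow-out at height `e` on `{g = 0}` and of the retraction on the level
  have hcont_Fl : ContinuousOn (fun z => Γ.Fl z e) {z | D.f z = 0} := by
    intro z₀ hz₀
    have hz₀a : D.f z₀ ≤ Γ.a := by rw [show D.f z₀ = 0 from hz₀]; exact ha.le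
    obtain ⟨hy, hzd⟩ := Γ.centre_spec hz₀a
    set C := Γ.bx (Γ.centre z₀) hy with hC
    have hεbox : e ≤ C.box.ε := hea.le.trans (Γ.a_le_ε _ hy)
    -- the box curve at the fixed time `e` is continuous on the box domain
    have hcurve : ContinuousOn (fun z => C.curve z e) C.dom := by
      have h : ContinuousOn (fun p : c.W × ℝ => C.curve p.1 p.2) (C.dom ×ˢ Icc 0 C.box.ε) :=
        (Γ.contMDiffOn_curve _ hy).continuousOn
      have h2 : ContinuousOn (fun z : c.W => (z, e)) C.dom :=
        (continuous_id.prodMk continuous_const).continuousOn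
      have h3 : MapsTo (fun z : c.W => (z, e)) C.dom (C.dom ×ˢ Icc 0 C.box.ε) := fun z hz =>
        Set.mk_mem_prod hz ⟨he0.le, hεbox⟩
      have h4 := h.comp h2 h3
      exact h4
    have hca : ContinuousAt (fun z => C.curve z e) z₀ :=
      hcurve.continuousAt (C.isOpen_dom.mem_nhds hzd)
    refine (hca.continuousWithinAt.congr_of_eventuallyEq ?_ ?_)
    · have hmem : C.dom ∩ {z | D.f z = 0} ∈ 𝓝[{z | D.f z = 0}] z₀ :=
        Filter.inter_mem (mem_nhdsWithin_of_mem_nhds (C.isOpen_dom.mem_nhds hzd)) self_mem_nhdsWithin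
      filter_upwards [hmem] with z hz
      have hza : D.f z ≤ Γ.a := by rw [show D.f z = 0 from hz.2]; exact ha.le
      exact Γ.Fl_eq_of_mem_dom hy hza hz.1 (by rw [show D.f z = 0 from hz.2, neg_zero]; exact ⟨he0.le, hea.le⟩)
    · exact Γ.Fl_eq_of_mem_dom hy hz₀a hzd (by rw [show D.f z₀ = 0 from hz₀, neg_zero]; exact ⟨he0.le, hea.le⟩)
  have hcont_ret : ContinuousOn Γ.ret {w | D.f w = e} := by
    intro w₀ hw₀
    have hw₀e : D.f w₀ = e := hw₀
    have hw₀a : D.f w₀ ≤ Γ.a := by rw [hw₀e]; exact hea.le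
    obtain ⟨hy, hwd⟩ := Γ.centre_spec hw₀a
    set C := Γ.bx (Γ.centre w₀) hy with hC
    have hεbox : e < C.box.ε := hea.trans_le (Γ.a_le_ε _ hy)
    have hcurve : ContinuousOn (fun z => C.curve z (-D.f z)) (C.dom ∩ {z | D.f z < C.box.ε}) :=
      (Γ.contMDiffOn_curve_neg _ hy).continuousOn
    have hopen : IsOpen (C.dom ∩ {z | D.f z < C.box.ε}) :=
      C.isOpen_dom.inter (isOpen_lt hgc continuous_const)
    have hw₀mem : w₀ ∈ C.dom ∩ {z | D.f z < C.box.ε} :=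
      ⟨hwd, by change D.f w₀ < _; rw [hw₀e]; exact hεbox⟩
    have hca : ContinuousAt (fun z => C.curve z (-D.f z)) w₀ :=
      hcurve.continuousAt (hopen.mem_nhds hw₀mem)
    refine hca.continuousWithinAt.congr_of_eventuallyEq ?_ ?_
    · have hmem : (C.dom ∩ {z | D.f z < C.box.ε}) ∩ {w | D.f w = e} ∈
          𝓝[{w | D.f w = e}] w₀ :=
        Filter.inter_mem (mem_nhdsWithin_of_mem_nhds (hopen.mem_nhds hw₀mem)) self_mem_nhdsWithin
      filter_upwards [hmem] with w hw
      have hwe : D.f w = e := hw.2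
      have hwa : D.f w ≤ Γ.a := by rw [hwe]; exact hea.le
      exact Γ.Fl_eq_of_mem_dom hy hwa hw.1.1 ⟨le_rfl, by linarith [D.f_nonneg w]⟩
    · exact Γ.Fl_eq_of_mem_dom hy hw₀a hwd ⟨le_rfl, by linarith [D.f_nonneg w₀]⟩
  -- the homeomorphism `range inl ≃ₜ f⁻¹(ε)`
  have hg_range : ∀ z ∈ range c.inl, D.f z = 0 := by
    rintro _ ⟨x, rfl⟩; exact hg_inl x
  let Φ : ↥(range c.inl) ≃ₜ ↥(f ⁻¹' {ε}) :=
    { toFun := fun z => ⟨Γ.Fl z e, by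
        obtain ⟨x, hx⟩ := z.2
        change f (Γ.Fl z e) = ε
        rw [← hx]; exact hFl_lev x⟩
      invFun := fun w => ⟨Γ.ret w, hret_mem w w.2⟩
      left_inv := fun z => by
        ext
        change Γ.ret (Γ.Fl z e) = z
        exact Γ.ret_Fl (hg_range z z.2) ⟨he0.le, hea.le⟩
      right_inv := fun w => by
        ext
        change Γ.Fl (Γ.ret w) e = w
        have hw : f (w : c.W) = ε := w.2
        have h := Γ.Fl_ret (z := (w : c.W)) (by rw [hg_lev w hw]; exact hea.le)
        rwa [hg_lev w hw] at h
      continuous_toFun := by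
        refine Continuous.subtype_mk ?_ _
        exact hcont_Fl.comp_continuous continuous_subtype_val fun z => hg_range z z.2
      continuous_invFun := by
        refine Continuous.subtype_mk ?_ _
        exact hcont_ret.comp_continuous continuous_subtype_val fun w => hg_lev w w.2 }
  exact ⟨c.isSmoothEmbedding_inl.isEmbedding.toHomeomorph.trans Φ⟩

/-- **The levels near the outgoing end are homeomorphic to it**: for a Morse function `f` on a
cobordism `(W; M, N)` there is `ε₀ > 0` with `N ≃ₜ f⁻¹(1 - ε)` for every `0 < ε ≤ ε₀` (turn
the cobordism about: `1 - f` is a Morse function on `(W; N, M)`). [cite: MilnorHCobordism1965, Thm. 3.4, Cor. 3.5 (PDF pp. 12–13), proof of Thm. 9.1 (PDF p. 57)] -/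
theorem exists_homeomorph_level' {c : Cobordism n M N} {f : c.W → ℝ} (hf : c.IsMorseFunction f) :
    ∃ ε₀ : ℝ, 0 < ε₀ ∧ ∀ ε, 0 < ε → ε ≤ ε₀ → Nonempty (N ≃ₜ ↥(f ⁻¹' {1 - ε})) := by
  obtain ⟨ε₀, hε₀, h⟩ := hf.symm.exists_homeomorph_level
  refine ⟨ε₀, hε₀, fun ε hε hεε₀ => ?_⟩
  obtain ⟨e⟩ := h ε hε hεε₀
  have hset : ((fun z : c.W => 1 - f z) ⁻¹' {ε}) = f ⁻¹' {1 - ε} := by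
    ext z
    simp only [mem_preimage, mem_singleton_iff]
    constructor <;> intro hz <;> linarith
  exact ⟨e.trans (Homeomorph.setCongr hset)⟩

end Cobordism.IsMorseFunction

end Literature.Topology.FourManifolds
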